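import Summits.ResolutionOfSingularities.ResolutionOfSingularities.Theorems.EquisingularLiftEquisingularLiftNatSpecimenWhitneyCubicCiNose
import Summits.ResolutionOfSingularities.ResolutionOfSingularities.Theorems.EquisingularLiftEquisingularLiftNatStubElnatCiNoseThenPoints
import Summits.ResolutionOfSingularities.ResolutionOfSingularities.Theorems.EquisingularLiftEquisingularLiftNatNoseThenPointsHorizIntrinsic
import HarnessLib

/-!
# [OURS · L1 W4.5(b) · EL♮(3)] The landed rung `stub_elnat_ciNoseThenPoints` APPLIED to the Whitney-type cubic BY NAME, and the `hloc`-free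
# horizontal conclusion for it (SPECIMEN-W, rider to res-D-pv-013's non-vacuity certificate)

Cell `res-hironaka`, rung L, slot W4.5(b); crux **EL♮(3)** (stmt-ResolutionOfSingularities-20148; parent EL♮ stmt-20038), line `sections`, rung
v6-NONISO `stub_elnat_ciNoseThenPoints` (LANDED, res-D-pv-027 p524326). Helper `--supports … --as helper` by res-type-051 (g14). OURS; NOT a
statement of any manuscript; AI-written, weaker than expert review. No definition, no `sorry`, standard axioms.

res-D-pv-013's `WhitneyCubic.ciNoseThenPoints_hypothesis_whitneyCubic` (…NatSpecimenWhitneyCubicCiNose.lean) inhabits the registered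
stub's downstairs `∃ (c, f, d, …)` block for res-D-pv-022's R2 cubic `H = V₊(x₁x₂² − x₀x₃²) ⊂ ℙ³_k` with `Σ = V(x₂, x₃)`. This rider adds the
two kernel checks a reader wants next:

* `WhitneyCubic.stub_elnat_ciNoseThenPoints_whitneyCubic` — the LANDED stub CONSUMES that certificate BY NAME (modulo the item's locally-
  principal binder `hloc` for `ι`, kept as a hypothesis exactly as in the registered text) and returns the rung's conclusion for
  `(k, 3, H, ι)`: kernel evidence that the certificate is literally the registered hypothesis block;
* `WhitneyCubic.horizAt_whitneyCubic` — the SAME conclusion with NO `hloc`, through res-type-051's intrinsic route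
  `horizAt_of_nose_of_isRegular_blowup_closed` (p518889) fed by res-D-pv-027's (LIFT) `CILift.ciLift` (p522728), pv-013's `Σ`-lemmas and
  pv-022's `WhitneyCubic.isRegular_of_isBlowup_comap` (p511043). (R2's `elNatAt_whitneyCubic` is the same geometry in the ITEM's currency by one
  explicit linear step; here it comes out of the v6 rung's machinery in the HORIZONTAL currency.)

References: p524326, p522728, p518889, p511043; res-D-pv-013's certificate file; [Hartshorne1977] II Prop. 5.9.
-/

set_option linter.dupNamespace false -- mandated namespace `Summit.<Summit>.<Problem>` of this single-conjunct summit

noncomputable section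

open CategoryTheory CategoryTheory.Limits AlgebraicGeometry TopologicalSpace IsLocalRing
open MvPolynomial HomogeneousLocalization
open Literature.AlgebraicGeometry.Resolution
open Literature.AlgebraicGeometry.Motives Literature.AlgebraicGeometry.Motives.SmoothHypersurface
open Literature.AlgebraicGeometry.Motives.ProjectiveSpace
open AlgebraicGeometry.Scheme.IdealSheafData

namespace Summit.ResolutionOfSingularities.ResolutionOfSingularities.Cruxes.EquisingularLiftNat.Sections

namespace WhitneyCubic

variable (k : Type) [Field k]

attribute [local instance] MvPolynomial.gradedAlgebra

/-- **The rung APPLIED to the Whitney-type cubic** (`k` algebraically closed of characteristic `p`): modulo the item's locally-principal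
binder `hloc` for `ι` (as in the registered text), the landed stub `stub_elnat_ciNoseThenPoints` (p524326) consumes res-D-pv-013's
certificate `ciNoseThenPoints_hypothesis_whitneyCubic k` BY NAME. [folklore; assembly] -/
theorem stub_elnat_ciNoseThenPoints_whitneyCubic {p : ℕ} (hp : p.Prime) [CharP k p] [IsAlgClosed k]
    (hloc : (∀ y : (Literature.AlgebraicGeometry.Motives.projectiveSpace 3 k).left, ∃ U : (Literature.AlgebraicGeometry.Motives.projectiveSpace 3 k).left.affineOpens, y ∈ (U : (Literature.AlgebraicGeometry.Motives.projectiveSpace 3 k).left.Opens) ∧ ((Literature.AlgebraicGeometry.Motives.SmoothHypersurface.hypersurfaceι (form k)).left.ker.ideal U).IsPrincipal)) :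
    ∃ (O : Type) (_ : CommRing O) (_ : IsDomain O) (_ : IsDiscreteValuationRing O) (_ : CharZero O) (π : O →+* k), Function.Surjective π ∧ (letI := MvPolynomial.gradedAlgebra (σ := Fin (3 + 1)) (R := O); letI := MvPolynomial.gradedAlgebra (σ := Fin (3 + 1)) (R := k); ∀ (φ : MvPolynomial.homogeneousSubmodule (Fin (3 + 1)) O →+*ᵍ MvPolynomial.homogeneousSubmodule (Fin (3 + 1)) k) (hφ' : HomogeneousIdeal.irrelevant (MvPolynomial.homogeneousSubmodule (Fin (3 + 1)) k) ≤ (HomogeneousIdeal.irrelevant (MvPolynomial.homogeneousSubmodule (Fin (3 + 1)) O)).map φ), (∀ s, φ s = MvPolynomial.map π s) → ∀ Y : Set (AlgebraicGeometry.Proj (MvPolynomial.homogeneousSubmodule (Fin (3 + 1)) O)), Y = Set.range (CategoryTheory.CategoryStruct.comp (Literature.AlgebraicGeometry.Motives.SmoothHypersurface.hypersurfaceι (form k)).left (AlgebraicGeometry.Proj.map φ hφ') : (Literature.AlgebraicGeometry.Motives.SmoothHypersurface.hypersurface (form k)).left ⟶ (AlgebraicGeometry.Proj (MvPolynomial.homogeneousSubmodule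 (Fin (3 + 1)) O))) → ∃ (P' : AlgebraicGeometry.Scheme.{0}) (σ : P' ⟶ (AlgebraicGeometry.Proj (MvPolynomial.homogeneousSubmodule (Fin (3 + 1)) O))) (S' : Set P'), (∀ Q : (∀ X' : AlgebraicGeometry.Scheme.{0}, (X' ⟶ (AlgebraicGeometry.Proj (MvPolynomial.homogeneousSubmodule (Fin (3 + 1)) O))) → Set X' → Prop), Q (AlgebraicGeometry.Proj (MvPolynomial.homogeneousSubmodule (Fin (3 + 1)) O)) (CategoryTheory.CategoryStruct.id (AlgebraicGeometry.Proj (MvPolynomial.homogeneousSubmodule (Fin (3 + 1)) O))) Y → (∀ (X' X'' : AlgebraicGeometry.Scheme.{0}) (σ' : X' ⟶ (AlgebraicGeometry.Proj (MvPolynomial.homogeneousSubmodule (Fin (3 + 1)) O))) (Y' : Set X') (C : X'.IdealSheafData) (τ : X'' ⟶ X'), Q X' σ' Y' → Literature.AlgebraicGeometry.Resolution.IsBlowup τ C → Literature.AlgebraicGeometry.Resolution.Scheme.IsRegular C.subscheme → AlgebraicGeometry.Flat (CategoryTheory.CategoryStruct.comp C.subschemeι (CategoryTheory.CategoryStruct.comp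 σ' (CategoryTheory.CategoryStruct.comp (AlgebraicGeometry.Proj.toSpecZero (MvPolynomial.homogeneousSubmodule (Fin (3 + 1)) O)) (AlgebraicGeometry.Spec.map (CommRingCat.ofHom (algebraMap O (MvPolynomial.homogeneousSubmodule (Fin (3 + 1)) O 0))))))) → σ' '' (C.support : Set X') ⊆ {x | ¬ IsGenericPoint x Y} → (C.support : Set X') ∩ (CategoryTheory.CategoryStruct.comp σ' (CategoryTheory.CategoryStruct.comp (AlgebraicGeometry.Proj.toSpecZero (MvPolynomial.homogeneousSubmodule (Fin (3 + 1)) O)) (AlgebraicGeometry.Spec.map (CommRingCat.ofHom (algebraMap O (MvPolynomial.homogeneousSubmodule (Fin (3 + 1)) O 0)))))) ⁻¹' {IsLocalRing.closedPoint O} ⊆ Y' → Q X'' (CategoryTheory.CategoryStruct.comp τ σ') (closure (τ ⁻¹' (Y' \ (C.support : Set X'))))) → Q P' σ S') ∧ Literature.AlgebraicGeometry.Resolution.Scheme.IsRegular (AlgebraicGeometry.Scheme.IdealSheafData.vanishingIdeal (⟨closure S', isClosed_closure⟩ : TopologicalSpace.Closeds P')).subscheme) :=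
  stub_elnat_ciNoseThenPoints p hp k 3 (Literature.AlgebraicGeometry.Motives.SmoothHypersurface.hypersurface (form k)).left
    (Literature.AlgebraicGeometry.Motives.SmoothHypersurface.hypersurfaceι (form k)).left inferInstance (isIntegral_hypersurface k) hloc
    (ciNoseThenPoints_hypothesis_whitneyCubic k)

/-- Every blow-up of `H` along `𝓘(Σ) · 𝒪_H` is regular — pv-022's `isRegular_of_isBlowup_comap` in the `vanishingIdeal Σ` spelling
(pv-013's `ker_projMap_kill_eq_vanishingIdeal_doubleLine`). [folklore] -/
theorem isRegular_of_isBlowup_comap_vanishingIdeal_doubleLine (Z : Scheme.{0}) (ρ : Z ⟶ (hypersurface (form k)).left)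
    (hρ : IsBlowup ρ ((vanishingIdeal ⟨{y : (Literature.AlgebraicGeometry.Motives.projectiveSpace 3 k).left |
      ∀ i, (![X 2, X 3] : Fin 2 → MvPolynomial (Fin (3 + 1)) k) i ∈
        (y : ProjectiveSpectrum (MvPolynomial.homogeneousSubmodule (Fin (3 + 1)) k)).asHomogeneousIdeal}, isClosed_doubleLine k⟩).comap
      (hypersurfaceι (form k)).left)) :
    Scheme.IsRegular Z := by
  obtain ⟨fk, hfk', hfkC, hfkX⟩ :=
    Summit.ResolutionOfSingularities.ResolutionOfSingularities.Cruxes.EquisingularLift.StrataSplit.LinearCentre.exists_kill k 1 2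
  refine isRegular_of_isBlowup_comap k fk hfk' hfkC hfkX Z ρ ?_
  rwa [ker_projMap_kill_eq_vanishingIdeal_doubleLine k fk hfk' hfkC hfkX (isClosed_doubleLine k)]

/-- **The `hloc`-free HORIZONTAL conclusion for the Whitney-type cubic through the v6 machinery** (`k` algebraically closed of characteristic
`p`): `horizAt_of_nose_of_isRegular_blowup_closed` (p518889) with the (LIFT) supplier `CILift.ciLift` (p522728) for `Σ = V(x₂, x₃)` and pv-022's
regular blow-ups: over `O = 𝕎(k)`, for every graded `φ` over `π` and `Y = (ι ≫ Proj φ)(H)`, some `(P′, σ, S′)` in the HorizChainE1 closure of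
`(ℙ³_O, 𝟙, Y)` has regular `V(closure S′)_red`. [folklore] -/
theorem horizAt_whitneyCubic {p : ℕ} (hp : p.Prime) [CharP k p] [IsAlgClosed k] :
    ∃ (O : Type) (_ : CommRing O) (_ : IsDomain O) (_ : IsDiscreteValuationRing O) (_ : CharZero O) (π : O →+* k), Function.Surjective π ∧ (letI := MvPolynomial.gradedAlgebra (σ := Fin (3 + 1)) (R := O); letI := MvPolynomial.gradedAlgebra (σ := Fin (3 + 1)) (R := k); ∀ (φ : MvPolynomial.homogeneousSubmodule (Fin (3 + 1)) O →+*ᵍ MvPolynomial.homogeneousSubmodule (Fin (3 + 1)) k) (hφ' : HomogeneousIdeal.irrelevant (MvPolynomial.homogeneousSubmodule (Fin (3 + 1)) k) ≤ (HomogeneousIdeal.irrelevant (MvPolynomial.homogeneousSubmodule (Fin (3 + 1)) O)).map φ), (∀ s, φ s = MvPolynomial.map π s) → ∀ Y : Set (AlgebraicGeometry.Proj (MvPolynomial.homogeneousSubmodule (Fin (3 + 1)) O)), Y = Set.range (CategoryTheory.CategoryStruct.comp (Literature.AlgebraicGeometry.Motives.SmoothHypersurface.hypersurfaceι (form k)).left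 (AlgebraicGeometry.Proj.map φ hφ') : (Literature.AlgebraicGeometry.Motives.SmoothHypersurface.hypersurface (form k)).left ⟶ (AlgebraicGeometry.Proj (MvPolynomial.homogeneousSubmodule (Fin (3 + 1)) O))) → ∃ (P' : AlgebraicGeometry.Scheme.{0}) (σ : P' ⟶ (AlgebraicGeometry.Proj (MvPolynomial.homogeneousSubmodule (Fin (3 + 1)) O))) (S' : Set P'), (∀ Q : (∀ X' : AlgebraicGeometry.Scheme.{0}, (X' ⟶ (AlgebraicGeometry.Proj (MvPolynomial.homogeneousSubmodule (Fin (3 + 1)) O))) → Set X' → Prop), Q (AlgebraicGeometry.Proj (MvPolynomial.homogeneousSubmodule (Fin (3 + 1)) O)) (CategoryTheory.CategoryStruct.id (AlgebraicGeometry.Proj (MvPolynomial.homogeneousSubmodule (Fin (3 + 1)) O))) Y → (∀ (X' X'' : AlgebraicGeometry.Scheme.{0}) (σ' : X' ⟶ (AlgebraicGeometry.Proj (MvPolynomial.homogeneousSubmodule (Fin (3 + 1)) O))) (Y' : Set X') (C : X'.IdealSheafData) (τ : X'' ⟶ X'), Q X' σ' Y' → Literature.AlgebraicGeometry.Resolution.IsBlowup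 τ C → Literature.AlgebraicGeometry.Resolution.Scheme.IsRegular C.subscheme → AlgebraicGeometry.Flat (CategoryTheory.CategoryStruct.comp C.subschemeι (CategoryTheory.CategoryStruct.comp σ' (CategoryTheory.CategoryStruct.comp (AlgebraicGeometry.Proj.toSpecZero (MvPolynomial.homogeneousSubmodule (Fin (3 + 1)) O)) (AlgebraicGeometry.Spec.map (CommRingCat.ofHom (algebraMap O (MvPolynomial.homogeneousSubmodule (Fin (3 + 1)) O 0))))))) → σ' '' (C.support : Set X') ⊆ {x | ¬ IsGenericPoint x Y} → (C.support : Set X') ∩ (CategoryTheory.CategoryStruct.comp σ' (CategoryTheory.CategoryStruct.comp (AlgebraicGeometry.Proj.toSpecZero (MvPolynomial.homogeneousSubmodule (Fin (3 + 1)) O)) (AlgebraicGeometry.Spec.map (CommRingCat.ofHom (algebraMap O (MvPolynomial.homogeneousSubmodule (Fin (3 + 1)) O 0)))))) ⁻¹' {IsLocalRing.closedPoint O} ⊆ Y' → Q X'' (CategoryTheory.CategoryStruct.comp τ σ') (closure (τ ⁻¹' (Y' \ (C.support : Set X'))))) → Q P' σ S') ∧ Literature.AlgebraicGeometry.Resolution.Scheme.IsRegular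 (AlgebraicGeometry.Scheme.IdealSheafData.vanishingIdeal (⟨closure S', isClosed_closure⟩ : TopologicalSpace.Closeds P')).subscheme) := by
  haveI := isIntegral_hypersurface k
  refine horizAt_of_nose_of_isRegular_blowup_closed hp k 3 _
    (Literature.AlgebraicGeometry.Motives.SmoothHypersurface.hypersurfaceι (form k)).left _ (isClosed_doubleLine k)
    (doubleLine_subset_range_ι k) (not_range_ι_subset_doubleLine k) ?_ ?_
  · intro O _ _ _ _ _ _ π hπ
    exact CILift.ciLift k 3 O π hπ 2 ![X 2, X 3] (fun _ => 1)
      (fun i => ⟨le_rfl, by fin_cases i <;> exact isHomogeneous_X k _⟩) ⟨_, genericPoint_mem_doubleLine k⟩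
      (fun y _ => jacobian_clause_doubleLine k y) (isClosed_doubleLine k)
  · obtain ⟨Z, ρ, hρ⟩ := exists_isBlowup (hypersurface (form k)).left
      ((vanishingIdeal ⟨{y : (Literature.AlgebraicGeometry.Motives.projectiveSpace 3 k).left |
        ∀ i, (![X 2, X 3] : Fin 2 → MvPolynomial (Fin (3 + 1)) k) i ∈
          (y : ProjectiveSpectrum (MvPolynomial.homogeneousSubmodule (Fin (3 + 1)) k)).asHomogeneousIdeal}, isClosed_doubleLine k⟩).comap
        (hypersurfaceι (form k)).left)
    exact ⟨Z, ρ, hρ, isRegular_of_isBlowup_comap_vanishingIdeal_doubleLine k Z ρ hρ⟩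

end WhitneyCubic

end Summit.ResolutionOfSingularities.ResolutionOfSingularities.Cruxes.EquisingularLiftNat.Sections

end
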